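import Literature.Analysis.FluidPDE.NSBootstrapDefs
import Literature.Analysis.FluidPDE.NSSpinHeatProduct
import Literature.Analysis.FluidPDE.NSBoundedEnergyQuant
import Literature.Analysis.FluidPDE.NSVorticityBoundedTopQuant
import Literature.Analysis.FluidPDE.PoissonSliceGradient
import Literature.Analysis.FluidPDE.WeakSolutionProofs
import HarnessLib

/-!
# The Serrin bootstrap: level zero

Analysis/FluidPDE proofs file (theorems only). The base of the induction behind
`NSBoundedHigherRegularityBounds` (Seregin–Šverák 2009, §2 p. 8; Serrin 1962; Robinson–Rodrigo–
Sadowski 2016, Thm. 13.7, §13.3.2 Steps 1–2), on the normalised backward cylinder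
`Q(0, R) = ]-R², 0[ × B(0, R)`:

* `basePoisson_of_weakGradient` — the very weak Poisson equations `∫ u_b Δψ = -Σ_c ∫ A_{bc} ∂_cψ`
  (`A_{bc} = ∂_c u_b - ∂_b u_c`) from a weak spatial gradient and weak incompressibility;
* `spin_bound_backward_quant` — the spin entries are essentially bounded on `]-r², 0[ × B(0, r)`
  by a constant fixed before the solution, from a gradient bound: three rounds `2 → 3 → 6 → ∞`
  of `HeatDivForm.heatDivForm_improvement_top_quant` fed by the weak spin equation on product
  cylinders (`NSSpinHeatProd.spinHeat_identity_prod`) — the proof of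
  `SerrinTopQuant.spin_bound_top_quant`, run on backward instead of centred cylinders;
* `level_zero` — for `0 < r < R`, `M`, `P` a constant `K₀` such that every bounded distributional
  solution on `Q(0, R)` with `∫∫ |p|^{3/2} ≤ P` carries, on `C(r², r)`, a weak gradient `G`, the
  base identities `BaseHeat`, `BasePoisson` and level-`0` data bounded by `K₀`
  (`NSEnergyQuant.exists_weakGradient_energy_bound` supplies `G` and the gradient bound).

## References

* G. Seregin, V. Šverák, Comm. PDE 34 (2009) = arXiv:0804.1803, §2 p. 8. [`SereginSverak2009`]
* J. C. Robinson, J. L. Rodrigo, W. Sadowski, *The Three-Dimensional Navier–Stokes Equations*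
  (2016), Thm. 13.7, proof §13.3.2 Steps 1–2. [`RobinsonRodrigoSadowskiCUP2016`]
* J. Serrin, Arch. Rational Mech. Anal. 9 (1962) 187–195. [folklore]
-/

noncomputable section

open MeasureTheory Set Function Filter Topology TopologicalSpace Metric
open scoped NNReal ENNReal RealInnerProductSpace Laplacian

namespace Literature.Analysis.FluidPDE

namespace NSBootstrap

open RepDeriv SerrinTopQuant

variable {u : ℝ → EuclideanSpace ℝ (Fin 3) → EuclideanSpace ℝ (Fin 3)}
  {p : ℝ → EuclideanSpace ℝ (Fin 3) → ℝ}
  {G : ℝ → EuclideanSpace ℝ (Fin 3) → EuclideanSpace ℝ (Fin 3) →L[ℝ] EuclideanSpace ℝ (Fin 3)}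

/-! ### The very weak Poisson equations from the weak gradient and incompressibility -/

/-- The frame vectors are the coordinate vectors. [folklore] -/
theorem frame_apply (c : Fin 3) : (frame c : EuclideanSpace ℝ (Fin 3)) = EuclideanSpace.single c (1 : ℝ) :=
  EuclideanSpace.basisFun_apply _ _ _

/-- **The very weak Poisson equations of a weakly divergence-free field with a weak gradient**:
`∫ u_b Δψ = -Σ_c ∫ A_{bc} ∂_cψ` on a product cylinder, `A_{bc} = G_{bc} - G_{cb}`
(`∫ u_b ∂_c∂_cψ = -∫ G_{bc} ∂_cψ` by the weak gradient; `Σ_c ∫ G_{cb} ∂_cψ = -∫ ⟪u, ∇∂_bψ⟫ = 0`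
by the symmetry of second derivatives and weak incompressibility). [folklore] -/
theorem basePoisson_of_weakGradient {L ρ : ℝ}
    (hdiv : ∀ θ : ℝ → EuclideanSpace ℝ (Fin 3) → ℝ, IsSpaceTimeTestOn (cylOpens L ρ) θ →
      ∫ z in cyl L ρ, ⟪u z.1 z.2, gradient (θ z.1) z.2⟫ = 0)
    (hG : HasWeakSpatialGradientOn (cylOpens L ρ) u G) : BasePoisson u G L ρ := by
  intro b ψ hψ
  have hu : LocallyIntegrableOn (uncurry u) (cyl L ρ) volume := hG.locallyIntegrableOn
  have hGl : LocallyIntegrableOn (uncurry G) (cyl L ρ) volume := hG.locallyIntegrableOn_grad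
  have hψ2 : ∀ t, ContDiff ℝ 2 (ψ t) := fun t => (hψ.contDiff_slice t).of_le (by norm_cast)
  -- the second derivatives of `ψ` as test functions
  have hd : ∀ c, IsSpaceTimeTestOn (cylOpens L ρ) (fun t x => fderiv ℝ (ψ t) x (frame c)) := fun c =>
    NSSpinHeat.isSpaceTimeTestOn_fderiv_apply hψ (frame c)
  -- (1) `∫ u_b ∂_c∂_cψ = -∫ G_{bc} ∂_cψ`
  have h1 : ∀ c, ∫ q : ℝ × EuclideanSpace ℝ (Fin 3),
      u q.1 q.2 b * fderiv ℝ (fun y => fderiv ℝ (ψ q.1) y (frame c)) q.2 (frame c) =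
      -∫ q : ℝ × EuclideanSpace ℝ (Fin 3), NSSpinHeat.gradE G b c q * fderiv ℝ (ψ q.1) q.2 (frame c) := by
    intro c
    have h := NSSpinHeatProd.integral_test_mul_gradE hG (hd c) b c
    rw [← frame_apply] at h
    have e1 : ∫ q : ℝ × EuclideanSpace ℝ (Fin 3), NSSpinHeat.gradE G b c q * fderiv ℝ (ψ q.1) q.2 (frame c) =
        ∫ q : ℝ × EuclideanSpace ℝ (Fin 3), fderiv ℝ (ψ q.1) q.2 (frame c) * NSSpinHeat.gradE G b c q :=
      integral_congr_ae (Eventually.of_forall fun q => mul_comm _ _)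
    have e2 : ∫ q : ℝ × EuclideanSpace ℝ (Fin 3),
        u q.1 q.2 b * fderiv ℝ (fun y => fderiv ℝ (ψ q.1) y (frame c)) q.2 (frame c) =
        ∫ q : ℝ × EuclideanSpace ℝ (Fin 3),
          fderiv ℝ (fun y => fderiv ℝ (ψ q.1) y (frame c)) q.2 (frame c) * NSSpinHeat.velC u b q :=
      integral_congr_ae (Eventually.of_forall fun q => by simp only [NSSpinHeat.velC_apply]; ring)
    rw [e1, e2, h]
    ring
  -- (2) `∫ G_{cb} ∂_cψ = -∫ u_c ∂_b∂_cψ = -∫ u_c ∂_c∂_bψ`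
  have h2 : ∀ c, ∫ q : ℝ × EuclideanSpace ℝ (Fin 3), NSSpinHeat.gradE G c b q * fderiv ℝ (ψ q.1) q.2 (frame c) =
      -∫ q : ℝ × EuclideanSpace ℝ (Fin 3),
        u q.1 q.2 c * fderiv ℝ (fun y => fderiv ℝ (ψ q.1) y (frame b)) q.2 (frame c) := by
    intro c
    have h := NSSpinHeatProd.integral_test_mul_gradE hG (hd c) c b
    rw [← frame_apply] at h
    have e1 : ∫ q : ℝ × EuclideanSpace ℝ (Fin 3), NSSpinHeat.gradE G c b q * fderiv ℝ (ψ q.1) q.2 (frame c) =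
        ∫ q : ℝ × EuclideanSpace ℝ (Fin 3), fderiv ℝ (ψ q.1) q.2 (frame c) * NSSpinHeat.gradE G c b q :=
      integral_congr_ae (Eventually.of_forall fun q => mul_comm _ _)
    rw [e1, h]
    congr 1
    refine integral_congr_ae (Eventually.of_forall fun q => ?_)
    dsimp only
    rw [NSSpinHeat.velC_apply, SerrinBoundedHolder.fderiv_fderiv_apply_comm (hψ2 q.1) q.2 (frame c) (frame b)]
    ring
  -- (3) `Σ_c ∫ u_c ∂_c∂_bψ = ∫ ⟪u, ∇∂_bψ⟫ = 0`
  have h3 : ∑ c, ∫ q : ℝ × EuclideanSpace ℝ (Fin 3),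
      u q.1 q.2 c * fderiv ℝ (fun y => fderiv ℝ (ψ q.1) y (frame b)) q.2 (frame c) = 0 := by
    have hθ := hd b
    have h0 := hdiv _ hθ
    obtain ⟨-, -, hg0⟩ := IsSpaceTimeTestOn.continuous_gradient_field hθ
    have hz : ∀ q : ℝ × EuclideanSpace ℝ (Fin 3), q ∉ cyl L ρ →
        ⟪u q.1 q.2, gradient (fun y => fderiv ℝ (ψ q.1) y (frame b)) q.2⟫ = 0 := by
      intro q hq
      rw [hg0 q fun h => hq (hθ.tsupport_subset h), inner_zero_right]
    rw [setIntegral_eq_integral_of_forall_compl_eq_zero hz] at h0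
    have hint : ∀ c, Integrable (fun q : ℝ × EuclideanSpace ℝ (Fin 3) =>
        u q.1 q.2 c * fderiv ℝ (fun y => fderiv ℝ (ψ q.1) y (frame b)) q.2 (frame c)) volume := by
      intro c
      have huc : LocallyIntegrableOn (fun q : ℝ × EuclideanSpace ℝ (Fin 3) => u q.1 q.2 c) (cyl L ρ) volume :=
        (EuclideanSpace.proj c : EuclideanSpace ℝ (Fin 3) →L[ℝ] ℝ).locallyIntegrableOn_comp hu
      exact (isRepDeriv_nil (Q := cylOpens L ρ) huc).integrable_mul'
        (NSSpinHeat.isSpaceTimeTestOn_fderiv_apply hθ (frame c))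
    rw [← integral_finsetSum _ fun c _ => hint c, ← h0]
    refine integral_congr_ae (Eventually.of_forall fun q => ?_)
    dsimp only
    rw [inner_gradient_eq_sum_frame frame (u q.1 q.2) (fun y => fderiv ℝ (ψ q.1) y (frame b)) q.2]
    refine Finset.sum_congr rfl fun c _ => ?_
    rw [EuclideanSpace.inner_basisFun_real]
  -- assembly
  have hlap : ∫ q : ℝ × EuclideanSpace ℝ (Fin 3), u q.1 q.2 b * (Δ (ψ q.1)) q.2 =
      ∑ c, ∫ q : ℝ × EuclideanSpace ℝ (Fin 3),
        u q.1 q.2 b * fderiv ℝ (fun y => fderiv ℝ (ψ q.1) y (frame c)) q.2 (frame c) := by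
    have hint : ∀ c, Integrable (fun q : ℝ × EuclideanSpace ℝ (Fin 3) =>
        u q.1 q.2 b * fderiv ℝ (fun y => fderiv ℝ (ψ q.1) y (frame c)) q.2 (frame c)) volume := by
      intro c
      have hub : LocallyIntegrableOn (fun q : ℝ × EuclideanSpace ℝ (Fin 3) => u q.1 q.2 b) (cyl L ρ) volume :=
        (EuclideanSpace.proj b : EuclideanSpace ℝ (Fin 3) →L[ℝ] ℝ).locallyIntegrableOn_comp hu
      exact (isRepDeriv_nil (Q := cylOpens L ρ) hub).integrable_mul'
        (NSSpinHeat.isSpaceTimeTestOn_fderiv_apply (hd c) (frame c))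
    rw [← integral_finsetSum _ fun c _ => hint c]
    refine integral_congr_ae (Eventually.of_forall fun q => ?_)
    dsimp only
    rw [laplacian_eq_sum_sderivs (hψ2 q.1), Finset.mul_sum]
    rfl
  rw [hlap]
  have hsplit : ∀ c, ∫ q : ℝ × EuclideanSpace ℝ (Fin 3), spinEntry G b c q * fderiv ℝ (ψ q.1) q.2 (frame c) =
      (∫ q : ℝ × EuclideanSpace ℝ (Fin 3), NSSpinHeat.gradE G b c q * fderiv ℝ (ψ q.1) q.2 (frame c)) -
      ∫ q : ℝ × EuclideanSpace ℝ (Fin 3), NSSpinHeat.gradE G c b q * fderiv ℝ (ψ q.1) q.2 (frame c) := by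
    intro c
    have hi : ∀ i j, Integrable (fun q : ℝ × EuclideanSpace ℝ (Fin 3) =>
        NSSpinHeat.gradE G i j q * fderiv ℝ (ψ q.1) q.2 (frame c)) volume := fun i j =>
      (isRepDeriv_nil (Q := cylOpens L ρ) (NSSpinHeatProd.locallyIntegrableOn_gradE hGl i j)).integrable_mul' (hd c)
    rw [← integral_sub (hi b c) (hi c b)]
    refine integral_congr_ae (Eventually.of_forall fun q => ?_)
    simp only [spinEntry, NSSpinHeat.gradE_apply, frame_apply]
    ring
  simp_rw [hsplit, h1, h2]
  rw [Finset.sum_sub_distrib]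
  simp only [Finset.sum_neg_distrib, sub_neg_eq_add]
  rw [h3]
  ring


/-! ### Bounded spin on backward cylinders, with the bound fixed before the solution -/

set_option maxHeartbeats 1600000 in
/-- **Bounded spin up to the top of a backward cylinder, with the bound fixed before the
solution** (Robinson–Rodrigo–Sadowski 2016, Thm. 13.7, proof §13.3.2 Steps 1–2 for `q = q' = ∞`,
made quantitative; the proof of `SerrinTopQuant.spin_bound_top_quant` run on the backward cylinder
`Q(0, R) = ]-R², 0[ × B(0, R)`). For `0 < r < R`, `M`, `B` there is `K` such that for every
bounded distributional solution on `Q(0, R)` with `|u| ≤ M` a.e., a weak spatial gradient `G` and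
`∫∫ |G|² ≤ B`, the spin entries are essentially bounded by `K` on `]-r², 0[ × B(0, r)`.
[cite: RobinsonRodrigoSadowskiCUP2016, Thm. 13.7, proof §13.3.2 Steps 1–2 with (13.17) (q = q' = ∞)] -/
theorem spin_bound_backward_quant {R r : ℝ} (hr0 : 0 < r) (hrR : r < R) (M : ℝ) (B : ℝ≥0) :
    ∃ K : ℝ, 0 ≤ K ∧ ∀ (u : ℝ → EuclideanSpace ℝ (Fin 3) → EuclideanSpace ℝ (Fin 3))
      (p : ℝ → EuclideanSpace ℝ (Fin 3) → ℝ)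
      (G : ℝ → EuclideanSpace ℝ (Fin 3) → EuclideanSpace ℝ (Fin 3) →L[ℝ] EuclideanSpace ℝ (Fin 3)),
      IsDistributionalNSSolutionOn (cylOpens (R ^ 2) R) 1 0 u p →
      (∀ᵐ w ∂(volume.restrict (cyl (R ^ 2) R)), ‖u w.1 w.2‖ ≤ M) →
      HasWeakSpatialGradientOn (cylOpens (R ^ 2) R) u G →
      (∫⁻ w in cyl (R ^ 2) R, ENNReal.ofReal (frobeniusNormSq (G w.1 w.2)) ≤ B) →
      ∀ᵐ w ∂(volume.restrict (cyl (r ^ 2) r)), ∀ i j : Fin 3, |spinEntry G i j w| ≤ K := by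
  have hR0 : 0 < R := hr0.trans hrR
  have hsq : r ^ 2 < R ^ 2 := by nlinarith
  -- radii `r < ρ₂ < ρ₁ < R` and depths `r² < L₂ < L₁ < R²`
  set ρ₁ : ℝ := r + 2 * (R - r) / 3 with hρ₁
  set ρ₂ : ℝ := r + (R - r) / 3 with hρ₂
  have hrρ₂ : r < ρ₂ := by rw [hρ₂]; linarith
  have hρ₂ρ₁ : ρ₂ < ρ₁ := by rw [hρ₁, hρ₂]; linarith
  have hρ₁R : ρ₁ < R := by rw [hρ₁]; linarith
  have hρ₂0 : 0 < ρ₂ := hr0.trans hrρ₂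
  have hρ₁0 : 0 < ρ₁ := hρ₂0.trans hρ₂ρ₁
  set L₁ : ℝ := R ^ 2 - (R ^ 2 - r ^ 2) / 3 with hL₁
  set L₂ : ℝ := R ^ 2 - 2 * (R ^ 2 - r ^ 2) / 3 with hL₂
  have hL30 : 0 < r ^ 2 := by positivity
  have hL32 : r ^ 2 < L₂ := by rw [hL₂]; nlinarith
  have hL21 : L₂ < L₁ := by rw [hL₁, hL₂]; nlinarith
  have hL10 : L₁ < R ^ 2 := by rw [hL₁]; nlinarith
  have hL20 : 0 < L₂ := hL30.trans hL32
  have hL1pos : 0 < L₁ := hL20.trans hL21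
  -- the three constants, fixed before the solution
  obtain ⟨e23, e36, e6t⟩ := improvement_exponents
  obtain ⟨C₁, hC₁⟩ := HeatDivForm.heatDivForm_improvement_top_quant (m := 2) (r := 3) (by norm_num)
    (by norm_num) e23 (L := R ^ 2) (L' := L₁) (ρ := R) (ρ' := ρ₁) hL1pos hL10 hρ₁0 hρ₁R
  obtain ⟨C₂, hC₂⟩ := HeatDivForm.heatDivForm_improvement_top_quant (m := 3) (r := 6) (by norm_num)
    (by norm_num) e36 (L := L₁) (L' := L₂) (ρ := ρ₁) (ρ' := ρ₂) hL20 hL21 hρ₂0 hρ₂ρ₁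
  obtain ⟨C₃, hC₃⟩ := HeatDivForm.heatDivForm_improvement_top_quant (m := 6) (r := ⊤) (by norm_num)
    le_top e6t (L := L₂) (L' := r ^ 2) (ρ := ρ₂) (ρ' := r) hL30 hL32 hr0 hrρ₂
  set Aenn : ℝ≥0∞ := 1 + ENNReal.ofReal (2 * |M|) with hAenn
  have hAtop : Aenn ≠ ⊤ := by
    rw [hAenn]; exact ENNReal.add_ne_top.2 ⟨ENNReal.one_ne_top, ENNReal.ofReal_ne_top⟩
  set Kenn : ℝ≥0∞ := 9 * (C₃ : ℝ≥0∞) * Aenn * (9 * (C₂ : ℝ≥0∞) * Aenn *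
    (9 * (C₁ : ℝ≥0∞) * Aenn * (18 * (B : ℝ≥0∞) ^ (1 / 2 : ℝ)))) with hKenn
  have hKtop : Kenn ≠ ⊤ := by
    rw [hKenn]
    have hB : (B : ℝ≥0∞) ^ (1 / 2 : ℝ) ≠ ⊤ :=
      ENNReal.rpow_ne_top_of_nonneg (by norm_num) ENNReal.coe_ne_top
    have h18 : (18 : ℝ≥0∞) * (B : ℝ≥0∞) ^ (1 / 2 : ℝ) ≠ ⊤ := ENNReal.mul_ne_top (by norm_num) hB
    have h9 : ∀ C : ℝ≥0, 9 * (C : ℝ≥0∞) * Aenn ≠ ⊤ := fun C =>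
      ENNReal.mul_ne_top (ENNReal.mul_ne_top (by norm_num) ENNReal.coe_ne_top) hAtop
    exact ENNReal.mul_ne_top (h9 C₃) (ENNReal.mul_ne_top (h9 C₂) (ENNReal.mul_ne_top (h9 C₁) h18))
  refine ⟨Kenn.toReal, ENNReal.toReal_nonneg, ?_⟩
  intro u p G hsol hbd hG hGB
  have hG2 : ∫⁻ w in cyl (R ^ 2) R, ENNReal.ofReal (frobeniusNormSq (G w.1 w.2)) < ⊤ :=
    lt_of_le_of_lt hGB ENNReal.coe_lt_top
  -- the product cylinders sharing the top `0`
  have hsubC : ∀ {L ρ : ℝ}, L ≤ R ^ 2 → ρ ≤ R → cyl L ρ ⊆ cyl (R ^ 2) R := fun hL hρ => cyl_mono hL hρ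
  -- the weak equation for tests on any of them
  have heq : ∀ (L ρ : ℝ), L ≤ R ^ 2 → ρ ≤ R → ∀ (b c : Fin 3) (ψ : ℝ → EuclideanSpace ℝ (Fin 3) → ℝ),
      IsSpaceTimeTestOn (cylOpens L ρ) ψ →
      ∫ q : ℝ × EuclideanSpace ℝ (Fin 3), spinEntry G b c q * (timeDeriv ψ q.1 q.2 + (Δ (ψ q.1)) q.2) =
        ∫ q : ℝ × EuclideanSpace ℝ (Fin 3), ⟪spinFlux u G b c q, gradient (ψ q.1) q.2⟫ := by
    intro L ρ hL hρ b c ψ hψ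
    exact NSSpinHeatProd.spinHeat_identity_prod hsol hbd hG hG2 b c (hψ.mono (cylOpens_mono hL hρ))
  -- measurability and boundedness of `u`, measurability of `G`, on the product cylinders
  have hdata : ∀ (L ρ : ℝ), L ≤ R ^ 2 → ρ ≤ R →
      AEStronglyMeasurable (uncurry u) (volume.restrict (cyl L ρ)) ∧
      (∀ᵐ q ∂(volume.restrict (cyl L ρ)), ‖u q.1 q.2‖ ≤ M) ∧
      AEStronglyMeasurable (uncurry G) (volume.restrict (cyl L ρ)) := by
    intro L ρ hL hρ
    have hsub := hsubC hL hρ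
    exact ⟨(hsol.1.mono_set hsub).aestronglyMeasurable,
      ae_restrict_of_ae_restrict_of_subset hsub hbd,
      (hG.locallyIntegrableOn_grad.mono_set hsub).aestronglyMeasurable⟩
  -- one round of the improvement up to the top, for all entries at once, with the norms
  have round : ∀ (m m' : ℝ≥0∞) (L L' ρ ρ' : ℝ) (C : ℝ≥0), 1 ≤ m → L ≤ R ^ 2 → ρ ≤ R →
      (∀ (w : ℝ × EuclideanSpace ℝ (Fin 3) → ℝ) (g : ℝ × EuclideanSpace ℝ (Fin 3) → EuclideanSpace ℝ (Fin 3)),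
        MemLp w m (volume.restrict (cyl L ρ)) → MemLp g m (volume.restrict (cyl L ρ)) →
        (∀ ψ : ℝ → EuclideanSpace ℝ (Fin 3) → ℝ, IsSpaceTimeTestOn (cylOpens L ρ) ψ →
          ∫ q : ℝ × EuclideanSpace ℝ (Fin 3), w q * (timeDeriv ψ q.1 q.2 + (Δ (ψ q.1)) q.2) =
            ∫ q : ℝ × EuclideanSpace ℝ (Fin 3), ⟪g q, gradient (ψ q.1) q.2⟫) →
        MemLp w m' (volume.restrict (cyl L' ρ')) ∧
        eLpNorm w m' (volume.restrict (cyl L' ρ')) ≤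
          C * (eLpNorm w m (volume.restrict (cyl L ρ)) + eLpNorm g m (volume.restrict (cyl L ρ)))) →
      (∀ b c : Fin 3, MemLp (spinEntry G b c) m (volume.restrict (cyl L ρ))) →
      (∀ b c : Fin 3, MemLp (spinEntry G b c) m' (volume.restrict (cyl L' ρ'))) ∧
      ∑ b, ∑ c, eLpNorm (spinEntry G b c) m' (volume.restrict (cyl L' ρ')) ≤
        9 * (C : ℝ≥0∞) * Aenn * ∑ b, ∑ c, eLpNorm (spinEntry G b c) m (volume.restrict (cyl L ρ)) := by
    intro m m' L L' ρ ρ' C hm1 hL hρ hC hs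
    obtain ⟨hum, huM, hGm⟩ := hdata L ρ hL hρ
    set μ : Measure (ℝ × EuclideanSpace ℝ (Fin 3)) := volume.restrict (cyl L ρ) with hμ
    set μ' : Measure (ℝ × EuclideanSpace ℝ (Fin 3)) := volume.restrict (cyl L' ρ') with hμ'
    set S : ℝ≥0∞ := ∑ b, ∑ c, eLpNorm (spinEntry G b c) m μ with hS
    have hflux : ∀ b c : Fin 3, MemLp (spinFlux u G b c) m μ := memLp_spinFlux hum huM hs
    have hone : ∀ b c : Fin 3, MemLp (spinEntry G b c) m' μ' ∧
        eLpNorm (spinEntry G b c) m' μ' ≤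
          C * (eLpNorm (spinEntry G b c) m μ + eLpNorm (spinFlux u G b c) m μ) :=
      fun b c => hC _ _ (hs b c) (hflux b c) (heq L ρ hL hρ b c)
    refine ⟨fun b c => (hone b c).1, ?_⟩
    have hbound : ∀ b c : Fin 3, eLpNorm (spinEntry G b c) m' μ' ≤ (C : ℝ≥0∞) * Aenn * S := by
      intro b c
      calc eLpNorm (spinEntry G b c) m' μ'
          ≤ C * (eLpNorm (spinEntry G b c) m μ + eLpNorm (spinFlux u G b c) m μ) := (hone b c).2
        _ ≤ C * (S + ENNReal.ofReal (2 * |M|) * S) := by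
            gcongr
            · exact eLpNorm_spinEntry_le_sum G b c
            · exact eLpNorm_spinFlux_le hm1 huM hGm b c
        _ = (C : ℝ≥0∞) * Aenn * S := by rw [hAenn]; ring
    calc ∑ b, ∑ c, eLpNorm (spinEntry G b c) m' μ'
        ≤ ∑ _b : Fin 3, ∑ _c : Fin 3, (C : ℝ≥0∞) * Aenn * S :=
          Finset.sum_le_sum fun b _ => Finset.sum_le_sum fun c _ => hbound b c
      _ = 9 * (C : ℝ≥0∞) * Aenn * S := by
          simp only [Finset.sum_const, Finset.card_univ, Fintype.card_fin, nsmul_eq_mul]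
          push_cast
          ring
  -- start: `A ∈ L²` with `Σ ‖A_{ij}‖_{L²} ≤ 18 B^{1/2}`
  have hstart : ∀ b c : Fin 3, MemLp (spinEntry G b c) 2 (volume.restrict (cyl (R ^ 2) R)) := by
    intro b c
    have hGm : AEStronglyMeasurable (uncurry G) (volume.restrict (cyl (R ^ 2) R)) :=
      hG.locallyIntegrableOn_grad.aestronglyMeasurable
    have hG2' := memLp_two_uncurry_of_lintegral_frobeniusNormSq hGm hG2
    refine hG2'.of_le_mul (aestronglyMeasurable_spinEntry hGm b c) (c := 2)
      (Eventually.of_forall fun q => ?_)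
    rw [Real.norm_eq_abs]
    exact abs_spinEntry_le G b c q
  have hstartS : ∑ b, ∑ c, eLpNorm (spinEntry G b c) 2 (volume.restrict (cyl (R ^ 2) R)) ≤
      18 * (B : ℝ≥0∞) ^ (1 / 2 : ℝ) := by
    refine (sum_eLpNorm_spinEntry_two_le _ G).trans ?_
    gcongr
  -- three rounds
  obtain ⟨h3m, h3S⟩ := round 2 3 (R ^ 2) L₁ R ρ₁ C₁ (by norm_num) le_rfl le_rfl hC₁ hstart
  obtain ⟨h6m, h6S⟩ := round 3 6 L₁ L₂ ρ₁ ρ₂ C₂ (by norm_num) hL10.le hρ₁R.le hC₂ h3m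
  obtain ⟨-, htS⟩ := round 6 ⊤ L₂ (r ^ 2) ρ₂ r C₃ (by norm_num) (hL21.trans hL10).le
    (hρ₂ρ₁.trans hρ₁R).le hC₃ h6m
  -- the essential suprema bound all entries
  set μ₃ : Measure (ℝ × EuclideanSpace ℝ (Fin 3)) := volume.restrict (cyl (r ^ 2) r) with hμ₃
  have hchain : ∑ b, ∑ c, eLpNorm (spinEntry G b c) ⊤ μ₃ ≤ Kenn := by
    calc ∑ b, ∑ c, eLpNorm (spinEntry G b c) ⊤ μ₃
        ≤ 9 * (C₃ : ℝ≥0∞) * Aenn * ∑ b, ∑ c, eLpNorm (spinEntry G b c) 6 (volume.restrict (cyl L₂ ρ₂)) := htS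
      _ ≤ 9 * (C₃ : ℝ≥0∞) * Aenn * (9 * (C₂ : ℝ≥0∞) * Aenn *
            ∑ b, ∑ c, eLpNorm (spinEntry G b c) 3 (volume.restrict (cyl L₁ ρ₁))) := by gcongr
      _ ≤ 9 * (C₃ : ℝ≥0∞) * Aenn * (9 * (C₂ : ℝ≥0∞) * Aenn * (9 * (C₁ : ℝ≥0∞) * Aenn *
            ∑ b, ∑ c, eLpNorm (spinEntry G b c) 2 (volume.restrict (cyl (R ^ 2) R)))) := by gcongr
      _ ≤ Kenn := by rw [hKenn]; gcongr
  have hae : ∀ i j : Fin 3, ∀ᵐ q ∂μ₃, |spinEntry G i j q| ≤ Kenn.toReal := by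
    intro i j
    have hle : eLpNorm (spinEntry G i j) ⊤ μ₃ ≤ Kenn :=
      (eLpNorm_spinEntry_le_sum G i j).trans hchain
    filter_upwards [ae_le_eLpNormEssSup (f := spinEntry G i j) (μ := μ₃)] with q hq
    have h1 : ‖spinEntry G i j q‖ₑ ≤ Kenn := by
      refine hq.trans (le_trans (le_of_eq ?_) hle)
      rw [eLpNorm_exponent_top]
    rw [← Real.norm_eq_abs, ← toReal_enorm]
    exact (ENNReal.toReal_le_toReal enorm_ne_top hKtop).2 h1
  exact ae_all_iff.2 fun i => ae_all_iff.2 fun j => hae i j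

/-! ### Level zero -/

/-- The backward cylinder `Q(0, R)` is the normalised cylinder `C(R², R)`. [folklore] -/
theorem parabolicCylinder_zero_eq (R : ℝ) :
    parabolicCylinder R (0 : ℝ × EuclideanSpace ℝ (Fin 3)) = cyl (R ^ 2) R := by
  rw [parabolicCylinder]
  simp

/-- The same for the open sets. [folklore] -/
theorem parabolicCylinderOpens_zero_eq (R : ℝ) :
    parabolicCylinderOpens R (0 : ℝ × EuclideanSpace ℝ (Fin 3)) = cylOpens (R ^ 2) R := by
  ext1
  rw [coe_parabolicCylinderOpens, parabolicCylinder_zero_eq]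
  rfl

set_option maxHeartbeats 1600000 in
/-- **Level zero of the bootstrap** (Seregin–Šverák 2009, §2 p. 8, `k = 0`; Serrin 1962). For
`0 < r < R`, `M`, `P` there is `K₀` such that: every bounded distributional Navier–Stokes solution
`(u, p)` on `Q(0, R)` with `|u| ≤ M` a.e. and `∫∫ |p|^{3/2} ≤ P` has, on `C(r², r)`, a weak spatial
gradient `G` satisfying the base identities `BaseHeat`, `BasePoisson`, together with level-`0`
data bounded by `K₀` (`U [] b = u_b`, `A [] b c = A_{bc}`). [cite: SereginSverak2009, §2 p. 8] -/
theorem level_zero {R r : ℝ} (hr0 : 0 < r) (hrR : r < R) (M : ℝ) (P : ℝ≥0) :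
    ∃ K₀ : ℝ≥0, ∀ (u : ℝ → EuclideanSpace ℝ (Fin 3) → EuclideanSpace ℝ (Fin 3))
      (p : ℝ → EuclideanSpace ℝ (Fin 3) → ℝ),
      IsDistributionalNSSolutionOn (parabolicCylinderOpens R (0 : ℝ × EuclideanSpace ℝ (Fin 3))) 1 0 u p →
      (∀ᵐ w ∂(volume.restrict (parabolicCylinder R (0 : ℝ × EuclideanSpace ℝ (Fin 3)))), ‖u w.1 w.2‖ ≤ M) →
      (∫⁻ w in parabolicCylinder R (0 : ℝ × EuclideanSpace ℝ (Fin 3)), ‖p w.1 w.2‖ₑ ^ (3 / 2 : ℝ) ≤ P) →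
      ∃ G : ℝ → EuclideanSpace ℝ (Fin 3) → EuclideanSpace ℝ (Fin 3) →L[ℝ] EuclideanSpace ℝ (Fin 3),
        HasWeakSpatialGradientOn (cylOpens (r ^ 2) r) u G ∧ BaseHeat u G (r ^ 2) r ∧
        BasePoisson u G (r ^ 2) r ∧
        ∃ (U : List (Fin 3) → Fin 3 → ℝ × EuclideanSpace ℝ (Fin 3) → ℝ)
          (A : List (Fin 3) → Fin 3 → Fin 3 → ℝ × EuclideanSpace ℝ (Fin 3) → ℝ),
          LevelData u G (r ^ 2) r 0 K₀ U A := by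
  have hR0 : 0 < R := hr0.trans hrR
  -- an intermediate radius and the constants
  set r' : ℝ := (r + R) / 2 with hr'
  have hrr' : r < r' := by rw [hr']; linarith
  have hr'R : r' < R := by rw [hr']; linarith
  have hr'0 : 0 < r' := hr0.trans hrr'
  obtain ⟨CH, hCH⟩ := NSEnergyQuant.exists_weakGradient_energy_bound hr'0 hr'R
  set B : ℝ≥0 := CH * ((1 + |M|) ^ 3 * (1 + (P : ℝ))).toNNReal with hB
  obtain ⟨KS, hKS0, hKS⟩ := spin_bound_backward_quant hr0 hrr' M B
  set K₀ : ℝ≥0 := (max |M| KS).toNNReal with hK₀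
  refine ⟨K₀, fun u p hsol hbd hP => ?_⟩
  have hKM : |M| ≤ (K₀ : ℝ) := by rw [hK₀, Real.coe_toNNReal _ (le_max_of_le_left (abs_nonneg M))]; exact le_max_left _ _
  have hKK : KS ≤ (K₀ : ℝ) := by rw [hK₀, Real.coe_toNNReal _ (le_max_of_le_left (abs_nonneg M))]; exact le_max_right _ _
  -- the weak gradient and its bound on `Q(0, r')`
  obtain ⟨G, hG, -, hGb⟩ := hCH u p 0 M P hsol hbd hP
  rw [parabolicCylinderOpens_zero_eq] at hG hsol
  rw [parabolicCylinder_zero_eq] at hbd hGb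
  have hsub' : cyl (r' ^ 2) r' ⊆ cyl (R ^ 2) R := cyl_mono (by nlinarith) hr'R.le
  have hsub : cyl (r ^ 2) r ⊆ cyl (r' ^ 2) r' := cyl_mono (by nlinarith) hrr'.le
  have hsol' : IsDistributionalNSSolutionOn (cylOpens (r' ^ 2) r') 1 0 u p :=
    IsDistributionalNSSolutionOn.mono_holds hsol (cylOpens_mono (by nlinarith) hr'R.le)
  have hbd' : ∀ᵐ w ∂(volume.restrict (cyl (r' ^ 2) r')), ‖u w.1 w.2‖ ≤ M :=
    ae_restrict_of_ae_restrict_of_subset hsub' hbd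
  have hG' : HasWeakSpatialGradientOn (cylOpens (r' ^ 2) r') u G := hG.mono (cylOpens_mono (by nlinarith) hr'R.le)
  have hGB : ∫⁻ w in cyl (r' ^ 2) r', ENNReal.ofReal (frobeniusNormSq (G w.1 w.2)) ≤ B := by
    have e : (B : ℝ≥0∞) = CH * ENNReal.ofReal ((1 + |M|) ^ 3 * (1 + (P : ℝ))) := by
      rw [hB, ENNReal.coe_mul]; rfl
    rw [e]; exact hGb
  have hspin := hKS u p G hsol' hbd' hG' hGB
  -- everything on `C(r², r)`
  have hsolr : IsDistributionalNSSolutionOn (cylOpens (r ^ 2) r) 1 0 u p :=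
    IsDistributionalNSSolutionOn.mono_holds hsol' (cylOpens_mono (by nlinarith) hrr'.le)
  have hbdr : ∀ᵐ w ∂(volume.restrict (cyl (r ^ 2) r)), ‖u w.1 w.2‖ ≤ M :=
    ae_restrict_of_ae_restrict_of_subset hsub hbd'
  have hGr : HasWeakSpatialGradientOn (cylOpens (r ^ 2) r) u G := hG'.mono (cylOpens_mono (by nlinarith) hrr'.le)
  have hG2r : ∫⁻ w in cyl (r ^ 2) r, ENNReal.ofReal (frobeniusNormSq (G w.1 w.2)) < ⊤ :=
    lt_of_le_of_lt ((lintegral_mono_set hsub).trans hGB) ENNReal.coe_lt_top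
  have hur : LocallyIntegrableOn (uncurry u) (cyl (r ^ 2) r) volume := hGr.locallyIntegrableOn
  have hGlr : LocallyIntegrableOn (uncurry G) (cyl (r ^ 2) r) volume := hGr.locallyIntegrableOn_grad
  refine ⟨G, hGr, fun b c ψ hψ => NSSpinHeatProd.spinHeat_identity_prod hsolr hbdr hGr hG2r b c hψ,
    basePoisson_of_weakGradient (fun θ hθ => hsolr.2.2.2.1 θ hθ) hGr,
    fun _ b q => u q.1 q.2 b, fun _ b c q => spinEntry G b c q, ?_⟩
  intro γ hγ b c
  have hγ0 : γ = [] := List.eq_nil_of_length_eq_zero (Nat.le_zero.1 hγ)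
  subst hγ0
  simp only [List.map_nil]
  have hub : LocallyIntegrableOn (fun q : ℝ × EuclideanSpace ℝ (Fin 3) => u q.1 q.2 b) (cyl (r ^ 2) r) volume :=
    (EuclideanSpace.proj b : EuclideanSpace ℝ (Fin 3) →L[ℝ] ℝ).locallyIntegrableOn_comp hur
  have hAbc : LocallyIntegrableOn (spinEntry G b c) (cyl (r ^ 2) r) volume := by
    have h := (NSSpinHeatProd.locallyIntegrableOn_gradE hGlr b c).sub (NSSpinHeatProd.locallyIntegrableOn_gradE hGlr c b)
    exact h
  refine ⟨isRepDeriv_nil (Q := cylOpens (r ^ 2) r) hub, isRepDeriv_nil (Q := cylOpens (r ^ 2) r) hAbc, ?_, ?_⟩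
  · filter_upwards [hbdr] with q hq
    have h1 : |u q.1 q.2 b| ≤ ‖u q.1 q.2‖ := by
      simpa [Real.norm_eq_abs] using PiLp.norm_apply_le (u q.1 q.2) b
    exact ((h1.trans hq).trans (le_abs_self M)).trans hKM
  · filter_upwards [hspin] with q hq
    exact (hq b c).trans hKK


end NSBootstrap

end Literature.Analysis.FluidPDE

end
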